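import Summits.QuantumFields.BalabanUV.T4Continuum.Support.GradedWellSlice
import Summits.QuantumFields.BalabanUV.T4Continuum.Support.GradedSubBlockTents
import Summits.QuantumFields.BalabanUV.T4Continuum.Support.ScalarAveragedPropagator

/-!
# T⁴ programme, spine node NE2 (U1a), sub-row Δ1 — graded well, crew socket (GW-W1), file 2 of 4:
# THE GRADED TENT PLANTING `plantGW` (one tent per scalar row of the graded well, at the row's own scale) — exact graded means,
# level-free energy and graded mass

NE2 formalisation swarm `b2b-balaban-t4-ne2-formalise-*`, leaf 09 (gen 11), for the owner's socket (GW-W1) (R47 (e)/R48 (c)/R49 (a),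
journal 2026-08-21).  On leaf-05-g10's `GradedSubBlockTents` (`tentS`, `meanS_tentS`, `nsq_sdiff_tentS_le`) BY NAME.

WHY.  Two steps of the (GW-W1) transfer need a scalar field with PRESCRIBED graded means `Q′_GWn ψ = φ` and level-free energy:
(E) the graded mean correction of a unit gauge (file 3: the unit gauge Poincaré gives a gauge function with zero UNIT means; the
graded well's residual gauge group `N(Q′_GW)` asks for zero SUB-block means on the layers), and (S) the `H⁻¹`-type bound
`κ·‖Q′_GWnᴴφ‖² ≤ re⟨Q′_GWnᴴφ, G′_GW·Q′_GWnᴴφ⟩` of gen 8's `RegionGaugeSliceOrth.sliceCoercive_of_orthSlice` (file 4, by duality against a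
planted trial field — the (3.48) mechanism).  Both use the same object:

 * §1 `rowLift φ i` (a row function read on the scale-`s_i` anchors of layer `i`, zero elsewhere), **`plantGW φ := Σ_i tentS_{s_i} (rowLift φ i)`**;
   `tentS_rowLift_eq_zero_of_ne` (a layer-`j` tent vanishes on layer `i ≠ j`: the tents live inside their own sub-blocks, hence inside
   their own unit blocks).
 * §2 EXACT MEANS: **`meanS_plantGW`** / **`QsGWn_plantGW`**: `Q′_GWn (plantGW φ) = bfac • φ` row by row, `bfac_i = √(s_i^d)·β₁(s_i)^d > 0`
   (`β₁ ≥ 1/6`); hence **`QsGWn_plantGW_unplant`**: `Q′_GWn (plantGW (bfac⁻¹•φ)) = φ` — every row datum is planted exactly;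
   `QsGWw_plantGW_apply`, **`nsq_QsGWw_plantGW_unplant`**: the graded scalar MASS of the exact planting is `Σ_p L^{2i_p}|φ_p|² ≤ L^{2m}·‖φ‖²`.
 * §3 LEVEL-FREE ENERGY: `sum_mul_nsq_rowLift` (bookkeeping `Σ_i c_i·nsq (rowLift φ i) = Σ_p c_{i_p}|φ_p|²`), **`nsq_gradT_plantGW_le`**:
   `‖∂(plantGW φ)‖² ≤ 4d(m+1)·Σ_p (n²s_i^d/s_i²)|φ_p|²`, and for the exact planting **`nsq_gradT_plantGW_unplant_le`**:
   `‖∂(plantGW (bfac⁻¹•φ))‖² ≤ 4d(m+1)·36^d·L^{2m}·‖φ‖²` (`(n/s_i)² ≤ L^{2m}`, `β₁^{−2d} ≤ 36^d`) — LEVEL-FREE.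

HONEST FRAMING (T4-DAG p. 1).  [folklore] finite lattice calculus at model level (`U = 1`, one layer map on unit blocks, `m` fixed, finite
torus); constants ours; no estimate of print; NE2 (U1a) NOT proved; spine PROVED 0/9 unchanged; NOT [B9] (3.16)/(3.23)–(3.27)/(3.48) as
printed; NOT infinite volume / mass gap / Clay.  HONEST DEPENDENCY: continuum YM on T⁴ ⇐ BetaPertH ∧ nine spine estimates (0/9 proved);
BetaPertH ⇐ (D1) ∧ (D4) ∧ CAP+tail; G-an2-4 gates asym, D1 and NE2/3/4.  ABSOLUTE RULE kept: no `def … : Prop` fact, no cited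
hypothesis, zero `sorry`.
-/

noncomputable section

open scoped BigOperators ComplexConjugate Matrix
open Finset

namespace Summit.QuantumFields.BalabanUV.T4Continuum.GradedWellPlanting

open Literature.MathematicalPhysics.QuantumFieldTheory.Balaban1983to89.B5Prop11Plancherel (Tor fine)
open Literature.MathematicalPhysics.QuantumFieldTheory.Balaban1983to89.B5Prop11Lower (nsq nsq_nonneg)
open Literature.MathematicalPhysics.QuantumFieldTheory.Balaban1983to89.B5Blocks16 (blockOf)
open Literature.MathematicalPhysics.QuantumFieldTheory.Balaban1983to89.B5Action121 (GradOp sdiff)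
open Literature.MathematicalPhysics.QuantumFieldTheory.Balaban1983to89.B5G183RateUnitTower (lev lev_neZero)
open Summit.QuantumFields.BalabanUV.T4Continuum
open Summit.QuantumFields.BalabanUV.T4Continuum.ScalarBlockPoincare (nsq_sum_le)
open Summit.QuantumFields.BalabanUV.T4Continuum.ScalarBlockTrialFunction (beta1 beta1_ge)
open Summit.QuantumFields.BalabanUV.T4Continuum.ScalarAveragedPropagator (nsq_GradOp_mulVec dirichlet)
open Summit.QuantumFields.BalabanUV.T4Continuum.GradedSubBlocks (Anchor Anc InSub site meanS s_pos inSub_site meanS_mulVec sum_offsets_one)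
open Summit.QuantumFields.BalabanUV.T4Continuum.GradedSubBlocksRefine (anchorOf inSub_anchorOf blockOf_eq_of_inSub)
open Summit.QuantumFields.BalabanUV.T4Continuum.GradedSubBlockTents (tentS tentS_apply tentS_site meanS_tentS nsq_sdiff_tentS_le)
open Summit.QuantumFields.BalabanUV.T4Continuum.GradedWellData
open Summit.QuantumFields.BalabanUV.T4Continuum.GradedWellSlice (QsGWn sGW_dvd_lev)

variable {d : ℕ} (L : ℕ) [NeZero L] (M : Fin d → ℕ) [hM : ∀ μ, NeZero (M μ)] (k m : ℕ) (layer : Tor M → ℕ)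

/-! ## §1 The graded tent planting -/

/-- a row function read on the scale-`s_i` anchors of layer `i` (zero on the anchors of other layers). [folklore] -/
def rowLift (φ : RowS L M k m layer → ℂ) (i : Fin (m + 1)) : Anc (fine (lev L k) M) (sGW L k i) → ℂ :=
  fun z => if h : layer (blockOf (lev L k) M z.1) = (i : ℕ) then φ ⟨⟨i, z⟩, h⟩ else 0

/-- `rowLift` at a row's own anchor is the row value. [folklore] -/
theorem rowLift_row (φ : RowS L M k m layer → ℂ) (p : RowS L M k m layer) : rowLift L M k m layer φ p.1.1 p.1.2 = φ p := by
  obtain ⟨⟨i, z⟩, hp⟩ := p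
  simp only [rowLift, dif_pos hp]

/-- **THE GRADED TENT PLANTING**: one tent per scalar row, at the row's own scale — `plantGW φ = Σ_i tentS_{s_i}(rowLift φ i)`.
[cite: Balaban1985BackgroundPropagators, (3.48) p.398 (shape: trial functions per averaging row)] [folklore] -/
def plantGW (φ : RowS L M k m layer → ℂ) : TorK L M k → ℂ :=
  ∑ i : Fin (m + 1), tentS (fine (lev L k) M) (sGW L k i) (rowLift L M k m layer φ i)

/-- the unit block of the scale-`s` anchor of a site is the site's unit block. [folklore] -/
theorem blockOf_anchorOf (s : ℕ) [NeZero s] (hsn : s ∣ lev L k) (y : TorK L M k) :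
    blockOf (lev L k) M (anchorOf (fine (lev L k) M) s y).1 = blockOf (lev L k) M y :=
  (blockOf_eq_of_inSub (lev L k) M s hsn (inSub_anchorOf (fine (lev L k) M) s y)).symm

/-- **a layer-`j` tent vanishes at every site of a layer-`i` block, `i ≠ j`**. [folklore] -/
theorem tentS_rowLift_eq_zero_of_ne (φ : RowS L M k m layer → ℂ) {i j : Fin (m + 1)} (hij : j ≠ i) (y : TorK L M k)
    (hy : layer (blockOf (lev L k) M y) = (i : ℕ)) :
    tentS (fine (lev L k) M) (sGW L k j) (rowLift L M k m layer φ j) y = 0 := by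
  rw [tentS_apply]
  have h : ¬ layer (blockOf (lev L k) M (anchorOf (fine (lev L k) M) (sGW L k j) y).1) = (j : ℕ) := by
    rw [blockOf_anchorOf L M k (sGW L k j) (sGW_dvd_lev L k j), hy]
    exact fun h => hij (Fin.ext h.symm)
  simp only [rowLift, dif_neg h, zero_mul]

/-! ## §2 Exact graded means and the graded mass of a planting -/

/-- **THE SCALE-`s_i` MEAN OF A PLANTING AT A LAYER-`i` ROW IS `β₁(s_i)^d` TIMES THE ROW DATUM** (its own tent: leaf-05-g10's
`meanS_tentS`; the other layers' tents vanish on the row's unit block). [folklore] -/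
theorem meanS_plantGW (φ : RowS L M k m layer → ℂ) (p : RowS L M k m layer) :
    (meanS (fine (lev L k) M) (sGW L k p.1.1) *ᵥ plantGW L M k m layer φ) p.1.2 = (((beta1 (sGW L k p.1.1)) ^ d : ℝ) : ℂ) * φ p := by
  obtain ⟨⟨i, z⟩, hp⟩ := p
  unfold plantGW
  rw [Matrix.mulVec_sum, Finset.sum_apply, Finset.sum_eq_single i]
  · rw [meanS_tentS (fine (lev L k) M) (sGW L k i) (sGW_dvd L M k i), Pi.smul_apply, smul_eq_mul]
    simp only [rowLift, dif_pos hp]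
  · intro j _ hji
    rw [meanS_mulVec (fine (lev L k) M) (sGW L k i) (sGW_dvd L M k i)]
    rw [Finset.sum_eq_zero fun jj _ => ?_, mul_zero]
    refine tentS_rowLift_eq_zero_of_ne L M k m layer φ hji _ ?_
    rw [blockOf_eq_of_inSub (lev L k) M (sGW L k i) (sGW_dvd_lev L k i) (inSub_site (fine (lev L k) M) (sGW L k i) (sGW_dvd L M k i) z.2 jj)]
    exact hp
  · exact fun h => absurd (Finset.mem_univ i) h

/-- the planting factor `bfac_i = √(s_i^d)·β₁(s_i)^d`. [folklore] -/
def bfac (i : ℕ) : ℝ := Real.sqrt (((sGW L k i : ℕ) : ℝ) ^ d) * (beta1 (sGW L k i)) ^ d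

/-- `0 < bfac_i`. [folklore] -/
theorem bfac_pos (i : ℕ) : 0 < bfac L k (d := d) i := by
  unfold bfac
  have hs : (0 : ℝ) < ((sGW L k i : ℕ) : ℝ) := by exact_mod_cast s_pos (sGW L k i)
  exact mul_pos (Real.sqrt_pos.mpr (pow_pos hs d)) (pow_pos (beta1_ge (n := sGW L k i)).2 d)

/-- `(Q′_GWn ψ)_p = √(s_i^d)·(Q′_{s_i}ψ)(z_p)`. [folklore] -/
theorem QsGWn_mulVec_apply (ψ : TorK L M k → ℂ) (p : RowS L M k m layer) :
    (QsGWn L M k m layer *ᵥ ψ) p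
      = ((Real.sqrt (((sGW L k p.1.1 : ℕ) : ℝ) ^ d) : ℝ) : ℂ) * (meanS (fine (lev L k) M) (sGW L k p.1.1) *ᵥ ψ) p.1.2 := by
  simp only [Matrix.mulVec, dotProduct, QsGWn, QsGW, mul_assoc, ← Finset.mul_sum]

/-- `(Q′_GWw ψ)_p = w_i·(Q′_{s_i}ψ)(z_p)`. [folklore] -/
theorem QsGWw_mulVec_apply (ψ : TorK L M k → ℂ) (p : RowS L M k m layer) :
    (QsGWw L M k m layer *ᵥ ψ) p = ((wGW L k d p.1.1 : ℝ) : ℂ) * (meanS (fine (lev L k) M) (sGW L k p.1.1) *ᵥ ψ) p.1.2 := by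
  simp only [Matrix.mulVec, dotProduct, QsGWw, QsGW, mul_assoc, ← Finset.mul_sum]

/-- **`Q′_GWn (plantGW φ) = bfac • φ`** row by row. [folklore] -/
theorem QsGWn_plantGW (φ : RowS L M k m layer → ℂ) :
    QsGWn L M k m layer *ᵥ plantGW L M k m layer φ = fun p => ((bfac L k (d := d) p.1.1 : ℝ) : ℂ) * φ p := by
  funext p
  rw [QsGWn_mulVec_apply, meanS_plantGW, ← mul_assoc, bfac]
  push_cast
  ring

/-- the normalised row data `bfac⁻¹ • φ`. [folklore] -/
def unplant (φ : RowS L M k m layer → ℂ) : RowS L M k m layer → ℂ := fun p => (((bfac L k (d := d) p.1.1)⁻¹ : ℝ) : ℂ) * φ p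

/-- **EXACT PLANTING**: `Q′_GWn (plantGW (bfac⁻¹•φ)) = φ` — every graded row datum is realised by a scalar field. [folklore] -/
theorem QsGWn_plantGW_unplant (φ : RowS L M k m layer → ℂ) :
    QsGWn L M k m layer *ᵥ plantGW L M k m layer (unplant L M k m layer φ) = φ := by
  rw [QsGWn_plantGW]
  funext p
  have hb : (bfac L k (d := d) p.1.1 : ℝ) ≠ 0 := (bfac_pos L k p.1.1).ne'
  simp only [unplant]
  rw [← mul_assoc, ← Complex.ofReal_mul, mul_inv_cancel₀ hb, Complex.ofReal_one, one_mul]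

/-- `(Q′_GWw (plantGW φ))_p = w_i·β₁(s_i)^d·φ_p`. [folklore] -/
theorem QsGWw_plantGW_apply (φ : RowS L M k m layer → ℂ) (p : RowS L M k m layer) :
    (QsGWw L M k m layer *ᵥ plantGW L M k m layer φ) p = ((wGW L k d p.1.1 * (beta1 (sGW L k p.1.1)) ^ d : ℝ) : ℂ) * φ p := by
  rw [QsGWw_mulVec_apply, meanS_plantGW, ← mul_assoc]
  push_cast
  ring

omit hM in
/-- `w_i·β₁^d·bfac_i⁻¹ = L^i` in squares: `(w_i β₁(s_i)^d / bfac_i)² = L^{2i}`. [folklore] -/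
theorem wGW_mul_beta_div_bfac_sq (i : ℕ) : (wGW L k d i * (beta1 (sGW L k i)) ^ d * (bfac L k (d := d) i)⁻¹) ^ 2 = (L : ℝ) ^ (2 * i) := by
  have hs : (0 : ℝ) < ((sGW L k i : ℕ) : ℝ) := by exact_mod_cast s_pos (sGW L k i)
  have hβ : (0 : ℝ) < (beta1 (sGW L k i)) ^ d := pow_pos (beta1_ge (n := sGW L k i)).2 d
  have hsq : (0 : ℝ) < Real.sqrt (((sGW L k i : ℕ) : ℝ) ^ d) := Real.sqrt_pos.mpr (pow_pos hs d)
  unfold wGW bfac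
  field_simp
  ring

/-- **THE GRADED MASS OF THE EXACT PLANTING**: `‖Q′_GWw (plantGW (bfac⁻¹•φ))‖² = Σ_p L^{2 i_p}|φ_p|²`. [folklore] -/
theorem nsq_QsGWw_plantGW_unplant (φ : RowS L M k m layer → ℂ) :
    nsq (QsGWw L M k m layer *ᵥ plantGW L M k m layer (unplant L M k m layer φ))
      = ∑ p : RowS L M k m layer, (L : ℝ) ^ (2 * (p.1.1 : ℕ)) * ‖φ p‖ ^ 2 := by
  unfold nsq
  refine Finset.sum_congr rfl fun p _ => ?_
  rw [QsGWw_plantGW_apply]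
  simp only [unplant]
  rw [← mul_assoc, ← Complex.ofReal_mul, norm_mul, Complex.norm_real, mul_pow, Real.norm_eq_abs, sq_abs,
    wGW_mul_beta_div_bfac_sq]

/-- hence `‖Q′_GWw (plantGW (bfac⁻¹•φ))‖² ≤ L^{2m}·‖φ‖²` (`L ≥ 1`, `i ≤ m`). [folklore] -/
theorem nsq_QsGWw_plantGW_unplant_le (φ : RowS L M k m layer → ℂ) :
    nsq (QsGWw L M k m layer *ᵥ plantGW L M k m layer (unplant L M k m layer φ)) ≤ (L : ℝ) ^ (2 * m) * nsq φ := by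
  rw [nsq_QsGWw_plantGW_unplant]
  unfold nsq
  rw [Finset.mul_sum]
  refine Finset.sum_le_sum fun p _ => mul_le_mul_of_nonneg_right ?_ (sq_nonneg _)
  have hL1 : (1 : ℝ) ≤ L := by exact_mod_cast Nat.pos_of_ne_zero (NeZero.ne L)
  exact pow_le_pow_right₀ hL1 (by have := p.1.1.isLt; omega)

/-! ## §3 The level-free energy of a planting -/

/-- bookkeeping: `Σ_i c_i·nsq (rowLift φ i) = Σ_p c_{i_p}·|φ_p|²`. [folklore] -/
theorem sum_mul_nsq_rowLift (φ : RowS L M k m layer → ℂ) (c : Fin (m + 1) → ℝ) :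
    ∑ i : Fin (m + 1), c i * nsq (rowLift L M k m layer φ i) = ∑ p : RowS L M k m layer, c p.1.1 * ‖φ p‖ ^ 2 := by
  let P : ((i : Fin (m + 1)) × Anc (fine (lev L k) M) (sGW L k i)) → Prop := fun q => layer (blockOf (lev L k) M q.2.1) = q.1
  let F : ((i : Fin (m + 1)) × Anc (fine (lev L k) M) (sGW L k i)) → ℝ :=
    fun q => c q.1 * ‖rowLift L M k m layer φ q.1 q.2‖ ^ 2
  have key : ∑ q ∈ Finset.univ.filter P, F q = ∑ p : RowS L M k m layer, F p.1 :=
    Finset.sum_subtype (Finset.univ.filter P) (by intro x; simp [P]) F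
  have e1 : ∀ p : RowS L M k m layer, F p.1 = c p.1.1 * ‖φ p‖ ^ 2 := fun p => by
    simp only [F, rowLift_row]
  have e2 : ∑ q ∈ Finset.univ.filter P, F q = ∑ i : Fin (m + 1), c i * nsq (rowLift L M k m layer φ i) := by
    rw [Finset.sum_filter, Fintype.sum_sigma]
    refine Finset.sum_congr rfl fun i _ => ?_
    unfold nsq
    rw [Finset.mul_sum]
    refine Finset.sum_congr rfl fun z _ => ?_
    by_cases h : P ⟨i, z⟩
    · rw [if_pos h]
    · rw [if_neg h]
      have hz : rowLift L M k m layer φ i z = 0 := dif_neg h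
      simp [hz]
  rw [← e2, key]
  exact Finset.sum_congr rfl fun p _ => e1 p

/-- **THE ENERGY OF A PLANTING**: `‖∂(plantGW φ)‖² ≤ 4d(m+1)·Σ_p (n²·s_i^d/s_i²)·|φ_p|²` (Cauchy–Schwarz over the `m+1` layers, then
leaf-05-g10's `nsq_sdiff_tentS_le` per layer and direction). [folklore] -/
theorem nsq_gradT_plantGW_le (φ : RowS L M k m layer → ℂ) :
    nsq (gradT L M k *ᵥ plantGW L M k m layer φ)
      ≤ 4 * d * (m + 1) * ∑ p : RowS L M k m layer,
          ((lev L k : ℕ) : ℝ) ^ 2 * (((sGW L k p.1.1 : ℕ) : ℝ) ^ d / ((sGW L k p.1.1 : ℕ) : ℝ) ^ 2) * ‖φ p‖ ^ 2 := by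
  rw [nsq_GradOp_mulVec, dirichlet]
  have hν : ∀ ν : Fin d, nsq (sdiff (fine (lev L k) M) ((lev L k : ℕ) : ℂ) ν *ᵥ plantGW L M k m layer φ)
      ≤ (m + 1) * ∑ i : Fin (m + 1), ((lev L k : ℕ) : ℝ) ^ 2 * (4 * ((sGW L k i : ℕ) : ℝ) ^ d / ((sGW L k i : ℕ) : ℝ) ^ 2)
          * nsq (rowLift L M k m layer φ i) := by
    intro ν
    unfold plantGW
    rw [Matrix.mulVec_sum]
    refine (nsq_sum_le _ _).trans ?_
    rw [Finset.card_univ, Fintype.card_fin]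
    push_cast
    refine mul_le_mul_of_nonneg_left (Finset.sum_le_sum fun i _ => ?_) (by positivity)
    have h := nsq_sdiff_tentS_le (fine (lev L k) M) (sGW L k i) (sGW_dvd L M k i) ((lev L k : ℕ) : ℂ) ν (rowLift L M k m layer φ i)
    rw [Complex.norm_natCast] at h
    exact h
  calc ∑ ν, nsq (sdiff (fine (lev L k) M) ((lev L k : ℕ) : ℂ) ν *ᵥ plantGW L M k m layer φ)
      ≤ ∑ _ν : Fin d, ((m : ℝ) + 1) * ∑ i : Fin (m + 1), ((lev L k : ℕ) : ℝ) ^ 2 * (4 * ((sGW L k i : ℕ) : ℝ) ^ d / ((sGW L k i : ℕ) : ℝ) ^ 2)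
          * nsq (rowLift L M k m layer φ i) := Finset.sum_le_sum fun ν _ => hν ν
    _ = 4 * d * (m + 1) * ∑ p : RowS L M k m layer,
          ((lev L k : ℕ) : ℝ) ^ 2 * (((sGW L k p.1.1 : ℕ) : ℝ) ^ d / ((sGW L k p.1.1 : ℕ) : ℝ) ^ 2) * ‖φ p‖ ^ 2 := by
        rw [Finset.sum_const, Finset.card_univ, Fintype.card_fin, nsmul_eq_mul,
          ← sum_mul_nsq_rowLift L M k m layer φ (fun i => ((lev L k : ℕ) : ℝ) ^ 2 * (((sGW L k i : ℕ) : ℝ) ^ d / ((sGW L k i : ℕ) : ℝ) ^ 2))]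
        rw [Finset.mul_sum, Finset.mul_sum, Finset.mul_sum]
        refine Finset.sum_congr rfl fun i _ => ?_
        ring

omit hM in
/-- `n ≤ s_i·L^i` (with equality when `i ≤ k`; `s_i = L^{k−i}` truncated). [folklore] -/
theorem lev_le_sGW_mul_pow (i : ℕ) : ((lev L k : ℕ) : ℝ) ≤ ((sGW L k i : ℕ) : ℝ) * (L : ℝ) ^ i := by
  have hL1 : 1 ≤ L := Nat.pos_of_ne_zero (NeZero.ne L)
  have h : lev L k ≤ sGW L k i * L ^ i := by
    show lev L k ≤ lev L (k - i) * L ^ i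
    rw [lev_eq_pow, lev_eq_pow, ← pow_add]
    exact Nat.pow_le_pow_right hL1 (by omega)
  exact_mod_cast h

omit hM in
/-- the per-row energy coefficient of the exact planting: `n²·(s^d/s²)·bfac⁻² = (n/s)²·β₁(s)^{−2d}`. [folklore] -/
theorem energy_coeff_unplant (i : ℕ) :
    ((lev L k : ℕ) : ℝ) ^ 2 * (((sGW L k i : ℕ) : ℝ) ^ d / ((sGW L k i : ℕ) : ℝ) ^ 2) * ((bfac L k (d := d) i)⁻¹) ^ 2
      = (((lev L k : ℕ) : ℝ) / ((sGW L k i : ℕ) : ℝ)) ^ 2 * (((beta1 (sGW L k i)) ^ d)⁻¹) ^ 2 := by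
  have hs : (0 : ℝ) < ((sGW L k i : ℕ) : ℝ) := by exact_mod_cast s_pos (sGW L k i)
  have hβ : (0 : ℝ) < (beta1 (sGW L k i)) ^ d := pow_pos (beta1_ge (n := sGW L k i)).2 d
  have hsq : Real.sqrt (((sGW L k i : ℕ) : ℝ) ^ d) ^ 2 = ((sGW L k i : ℕ) : ℝ) ^ d := Real.sq_sqrt (pow_nonneg hs.le d)
  unfold bfac
  rw [inv_pow, inv_pow, mul_pow, hsq]
  field_simp

omit hM in
/-- the coefficient is LEVEL-FREE: `(n/s_i)²·β₁(s_i)^{−2d} ≤ 36^d·L^{2m}` for `i ≤ m`. [folklore] -/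
theorem energy_coeff_unplant_le (i : ℕ) (hi : i ≤ m) :
    (((lev L k : ℕ) : ℝ) / ((sGW L k i : ℕ) : ℝ)) ^ 2 * (((beta1 (sGW L k i)) ^ d)⁻¹) ^ 2 ≤ (36 : ℝ) ^ d * (L : ℝ) ^ (2 * m) := by
  have hs : (0 : ℝ) < ((sGW L k i : ℕ) : ℝ) := by exact_mod_cast s_pos (sGW L k i)
  have hβ := (beta1_ge (n := sGW L k i))
  have hL1 : (1 : ℝ) ≤ L := by exact_mod_cast Nat.pos_of_ne_zero (NeZero.ne L)
  have h1 : ((lev L k : ℕ) : ℝ) / ((sGW L k i : ℕ) : ℝ) ≤ (L : ℝ) ^ i := by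
    rw [div_le_iff₀ hs, mul_comm]
    exact lev_le_sGW_mul_pow L k i
  have h2 : (((lev L k : ℕ) : ℝ) / ((sGW L k i : ℕ) : ℝ)) ^ 2 ≤ (L : ℝ) ^ (2 * m) := by
    calc (((lev L k : ℕ) : ℝ) / ((sGW L k i : ℕ) : ℝ)) ^ 2 ≤ ((L : ℝ) ^ i) ^ 2 := pow_le_pow_left₀ (by positivity) h1 2
      _ = (L : ℝ) ^ (2 * i) := by rw [← pow_mul, mul_comm]
      _ ≤ (L : ℝ) ^ (2 * m) := pow_le_pow_right₀ hL1 (by omega)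
  have h3 : ((beta1 (sGW L k i)) ^ d)⁻¹ ≤ (6 : ℝ) ^ d := by
    rw [← inv_pow]
    refine pow_le_pow_left₀ (inv_nonneg.mpr hβ.2.le) ?_ d
    rw [inv_le_comm₀ hβ.2 (by norm_num)]
    linarith [hβ.1]
  have h4 : (((beta1 (sGW L k i)) ^ d)⁻¹) ^ 2 ≤ (36 : ℝ) ^ d := by
    calc (((beta1 (sGW L k i)) ^ d)⁻¹) ^ 2 ≤ ((6 : ℝ) ^ d) ^ 2 := pow_le_pow_left₀ (inv_nonneg.mpr (pow_nonneg hβ.2.le d)) h3 2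
      _ = (36 : ℝ) ^ d := by rw [← pow_mul, mul_comm, pow_mul]; norm_num
  calc _ ≤ (L : ℝ) ^ (2 * m) * (36 : ℝ) ^ d := mul_le_mul h2 h4 (by positivity) (by positivity)
    _ = (36 : ℝ) ^ d * (L : ℝ) ^ (2 * m) := mul_comm _ _

/-- **THE ENERGY OF THE EXACT PLANTING IS LEVEL-FREE**: `‖∂(plantGW (bfac⁻¹•φ))‖² ≤ 4d(m+1)·36^d·L^{2m}·‖φ‖²`. [folklore] -/
theorem nsq_gradT_plantGW_unplant_le (φ : RowS L M k m layer → ℂ) :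
    nsq (gradT L M k *ᵥ plantGW L M k m layer (unplant L M k m layer φ))
      ≤ 4 * d * (m + 1) * ((36 : ℝ) ^ d * (L : ℝ) ^ (2 * m)) * nsq φ := by
  refine (nsq_gradT_plantGW_le L M k m layer _).trans ?_
  rw [mul_assoc (4 * (d : ℝ) * (m + 1))]
  refine mul_le_mul_of_nonneg_left ?_ (by positivity)
  unfold nsq
  rw [Finset.mul_sum]
  refine Finset.sum_le_sum fun p _ => ?_
  simp only [unplant]
  rw [norm_mul, mul_pow, Complex.norm_real, Real.norm_eq_abs, sq_abs, ← mul_assoc, energy_coeff_unplant]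
  exact mul_le_mul_of_nonneg_right (energy_coeff_unplant_le L k m p.1.1 (Nat.le_of_lt_succ p.1.1.isLt)) (sq_nonneg _)

end Summit.QuantumFields.BalabanUV.T4Continuum.GradedWellPlanting

end
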